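import Literature.NumberTheory.EllipticCurves.OpenImage
import HarnessLib

/-!
# Denominators of `j(E)` when `ρ̄_{E,ℓ}` is not surjective (Zywina 2022)

Citation header. D. Zywina, *On the surjectivity of mod `ℓ` representations associated to elliptic
curves*, Bull. Lond. Math. Soc. **54** (2022), no. 6, doi:10.1112/blms.12701 = arXiv:1508.07661
(held: `paper:arxiv-1508.07661`; theorem numbers below are those of the arXiv version).
Standing hypothesis of the paper (§1, first sentence; §6, first sentence): *"Let `E` be a non-CM
elliptic curve defined over `ℚ`."*

* §1, display before Conjecture 1.1 — the exceptional set
  `S₀ := {(17, −17²·101³/2), (17, −17·373³/2¹⁷), (37, −7·11³), (37, −7·137³·2083³)}`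
  (*"When `(ℓ, j_E) ∈ S₀`, the curve `E` has an isogeny of degree `ℓ`"*; the two non-cuspidal,
  non-CM rational points of `X₀(17)` and of `X₀(37)`): `zywinaExceptionalPairs`.
* **Theorem 1.5** (proved in §4 of the paper, Tate-curve argument): *"Let `p₁^{e₁}⋯p_s^{e_s}` be
  the factorization of the denominator of `j_E`, where the `p_i` are distinct primes with `e_i > 0`.
  If `ρ_{E,ℓ}` is not surjective for a prime `ℓ > 13` with `(ℓ, j_E) ∉ S₀`, then each `p_i` is
  congruent to `±1` modulo `ℓ` and each `e_i` is divisible by `ℓ`."* — `zywina_nonsurjective_denominators`.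
* **Proposition 6.1**, the prime `ℓ = 11`, third item: *"If `j_E` is not an integer and `ρ_{E,11}`
  is not surjective, then the denominator of `j_E` is of the form `p₁^{e₁}⋯p_s^{e_s}` with `p_i`
  distinct primes such that `p_i ≡ ±1 (mod 11)` and `e_i ≡ 0 (mod 11)`."* (Zywina: "consequence
  of the theorems from [Zywina-images]" = arXiv:1508.07660) — `zywina_nonsurjective_denominators_eleven`.

Transcription into the tree's vocabulary (`GaloisAction.lean`, `Isogeny.lean`): "non-CM" =
`¬ W.HasCM` (geometric CM); "`ρ_{E,ℓ}` not surjective" = `¬ W.HasSurjectiveModNGaloisRep ℓ`;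
"`j_E` not an integer" = `W.j.den ≠ 1`; the prime-power factorisation of the denominator is read
through `Nat.factorization` (`e_q = (W.j.den).factorization q` for a prime `q ∣ W.j.den`);
"`q ≡ ±1 (mod ℓ)`" = `(q : ZMod ℓ) = 1 ∨ (q : ZMod ℓ) = -1`. Both statements are UNPROVED here
(named facts); consumer: `Summits/BirchSwinnertonDyer/Rank1Residual/AdditivePotMult/`
(the prime support of the reducible potentially multiplicative cell X3♯(M)).

References: [Zywina2022Surjectivity] Thm. 1.5, Prop. 6.1; [Zywina2015] (arXiv:1508.07660, the
`ℓ ≤ 11` image classification behind Prop. 6.1); [Mazur1978] Thm. 1 (behind `S₀`).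
-/

noncomputable section

namespace Literature.NumberTheory.EllipticCurves

/-- **Zywina's exceptional set `S₀`** of pairs `(ℓ, j)`:
`{(17, −17²·101³/2), (17, −17·373³/2¹⁷), (37, −7·11³), (37, −7·137³·2083³)}` — *"When
`(ℓ, j_E) ∈ S₀`, the curve `E` has an isogeny of degree `ℓ` and hence `ρ_{E,ℓ}` is not
surjective"* (the non-cuspidal non-CM rational points of `X₀(17)` and `X₀(37)`).
[cite: Zywina2022Surjectivity, §1, display before Conj. 1.1] -/
def zywinaExceptionalPairs : Finset (ℕ × ℚ) :=
  {(17, -(17 ^ 2 * 101 ^ 3) / 2), (17, -(17 * 373 ^ 3) / 2 ^ 17), (37, -(7 * 11 ^ 3)),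
    (37, -(7 * 137 ^ 3 * 2083 ^ 3))}

/-- `zywinaExceptionalPairs` has four elements. [cite: Zywina2022Surjectivity, §1] -/
theorem card_zywinaExceptionalPairs : zywinaExceptionalPairs.card = 4 := by
  simp only [zywinaExceptionalPairs]
  norm_num [Finset.card_insert_of_notMem, Prod.mk.injEq]

/-- **Zywina 2022, Theorem 1.5** (arXiv:1508.07661 numbering; standing hypothesis: `E/ℚ`
non-CM): *"Let `p₁^{e₁}⋯p_s^{e_s}` be the factorization of the denominator of `j_E`, where the
`p_i` are distinct primes with `e_i > 0`. If `ρ_{E,ℓ}` is not surjective for a prime `ℓ > 13` with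
`(ℓ, j_E) ∉ S₀`, then each `p_i` is congruent to `±1` modulo `ℓ` and each `e_i` is divisible by
`ℓ`."* Transcription: for every prime `q` dividing `den j(E)`: `q ≡ ±1` in `ZMod ℓ` and
`ℓ ∣ (den j(E)).factorization q`. Unproved here (named fact).
[cite: Zywina2022Surjectivity, Thm. 1.5] -/
def zywina_nonsurjective_denominators : Prop :=
  ∀ (W : WeierstrassCurve ℚ) [W.IsElliptic], ¬ W.HasCM → ∀ ℓ : ℕ, ℓ.Prime → 13 < ℓ →
    (ℓ, W.j) ∉ zywinaExceptionalPairs → ¬ W.HasSurjectiveModNGaloisRep ℓ →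
      ∀ q : ℕ, q.Prime → q ∣ W.j.den →
        ((q : ZMod ℓ) = 1 ∨ (q : ZMod ℓ) = -1) ∧ ℓ ∣ W.j.den.factorization q

/-- **Zywina 2022, Proposition 6.1, `ℓ = 11`, third item** (arXiv:1508.07661 numbering; standing
hypothesis: `E/ℚ` non-CM): *"If `j_E` is not an integer and `ρ_{E,11}` is not surjective, then
the denominator of `j_E` is of the form `p₁^{e₁}⋯p_s^{e_s}` with `p_i` distinct primes such that
`p_i ≡ ±1 (mod 11)` and `e_i ≡ 0 (mod 11)`."* Transcription: `den j(E) ≠ 1`,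
`¬ HasSurjectiveModNGaloisRep 11`; for every prime `q ∣ den j(E)`: `q ≡ ±1` in `ZMod 11` and
`11 ∣ (den j(E)).factorization q`. Unproved here (named fact).
[cite: Zywina2022Surjectivity, Prop. 6.1 (ℓ = 11, third item)] -/
def zywina_nonsurjective_denominators_eleven : Prop :=
  ∀ (W : WeierstrassCurve ℚ) [W.IsElliptic], ¬ W.HasCM → W.j.den ≠ 1 →
    ¬ W.HasSurjectiveModNGaloisRep 11 →
      ∀ q : ℕ, q.Prime → q ∣ W.j.den →
        ((q : ZMod 11) = 1 ∨ (q : ZMod 11) = -1) ∧ 11 ∣ W.j.den.factorization q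

end Literature.NumberTheory.EllipticCurves

end
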